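import Summits.AnomalousDissipation.AnomalousDissipation.Theorems.SolenoidalFractalHomogenisationLagrangianStepCellChainClassPair
import Literature.Analysis.FluidPDE.PassiveVectorTensorDistortedConstFrameSymmetry
import Literature.Analysis.FluidPDE.PassiveVectorTensorDistortedConstFrameFourier
import HarnessLib

/-!
# K1L_D (stmt-AnomalousDissipation-27980), (ℓ3) — CLASS-PAIR CONFINEMENT of every weak solution of the FROZEN-FRAME tensor cell problem
# (helper; `--supports stmt-AnomalousDissipation-27980 --as helper`)

Port plan B5 (`HOME/ad-sawtooth-k1loc-p1/g16/W7thg-portplan-k1locp1g16.md`; prover ad-sawtooth-k1loc-p1 g16): the frozen-frame twin of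
`…CellChainClassPair` (w1 g4).  For a CONSTANT non-degenerate frame `G₀` (`c₀|k|² ≤ |G₀ᵀk|²`, `0 < c₀` — e.g. `c₀ = (1−3θ)²` for `|G₀ − 1| ≤ θ < 1/3`,
`ThreeMode.le_freqNormSq_twist`) the distorted cell problem along `cellField W M hM ν n` (which is `1/n`-periodic) preserves every conjugate pair of Bloch
classes: if the `L²` datum `F` has no modes off `(ℓ + nℤ³) ∪ (−ℓ + nℤ³)`, then so has every constant-frame distorted weak solution, for a.e. `t ∈ (0,T)`
(`Literature/…/PassiveVectorTensorDistortedConstFrameSymmetry.ae_mFourierCoeff_eq_zero_off_sector_constFrame` on the `n`-torsion grid).  Shared input of the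
(V_θg) frozen substrate (w1 lineage L2) and of the (W_θg) class reduction / setup (this lineage, B6/B12).
* `ae_modes_vanish_off_classPair_frame`, `ae_modeCoeff_vanish_off_classPair_frame`.
No definitions, no sorry.  NOT a proof of any registered stub, of K1L_D or of AD; rung F-D1.A0.
[cite: KhaKuchment2021, §1.1–§1.2 (G-periodic operators, γ_k-automorphic functions)] [problem: turb]
-/

set_option linter.dupNamespace false

noncomputable section

namespace Summit.AnomalousDissipation.AnomalousDissipation.Theorems.SolenoidalFractalHomogenisation.LagrangianStep.CellChain

open Set MeasureTheory Filter Topology Function Complex UnitAddTorus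
open scoped InnerProductSpace ENNReal
open Literature.Analysis Literature.Analysis.FunctionSpaces Literature.Analysis.FunctionSpaces.Torus
open Literature.Analysis.FluidPDE Literature.Analysis.FluidPDE.LatticeShear
open Summit.AnomalousDissipation.AnomalousDissipation.Theorems.SolenoidalFractalHomogenisation.RealisedQuasiStaticCellLaw
open Summit.AnomalousDissipation.AnomalousDissipation.Theorems.SolenoidalFractalHomogenisation.LagrangianStep

/-- **Class-pair confinement of every weak solution of the FROZEN-FRAME tensor cell problem.**  If the `L²` datum `F` has no modes off the
conjugate pair of Bloch classes `(ℓ + nℤ³) ∪ (−ℓ + nℤ³)`, then so does every constant-frame distorted weak solution along the cell carrier, for a.e.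
`t ∈ (0,T)` (non-degenerate frame `c₀|k|² ≤ |G₀ᵀk|²`, `0 < c₀`). [cite: KhaKuchment2021, §1.1–§1.2 (G-periodic operators, γ_k-automorphic functions)] -/
theorem ae_modes_vanish_off_classPair_frame {k : ℕ} (W : LatticeWord k) (M : ℝ) (hM : 0 < M) {lo hi lam ν : ℝ} (hlo : 0 < lo)
    (hlam : 0 < lam) (hν : 0 < ν) {n : ℕ} (hn : 0 < n) {𝔸 : Torus.Visc4 (Fin 3)}
    (hA : Torus.NearIso 𝔸 (ν * (lo / lam)) (ν * (hi * lam))) {G₀ : Matrix (Fin 3) (Fin 3) ℝ} {c₀ : ℝ} (hc₀ : 0 < c₀)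
    (hG : ∀ k' : Fin 3 → ℤ, c₀ * freqNormSq k' ≤ ∑ a, Torus.twistFreq G₀ k' a ^ 2)
    (ℓ : Fin 3 → ℤ) {F : VF} (hF : MemLp F 2 volume)
    (hsupp : ∀ k' : Fin 3 → ℤ, (¬ ∃ z : Fin 3 → ℤ, k' = ℓ + (n : ℤ) • z) → (¬ ∃ z : Fin 3 → ℤ, k' = -ℓ + (n : ℤ) • z) →
      mFourierCoeff (FunctionSpaces.EuclideanSpace.complexify ∘ F) k' = 0)
    {T : ℝ} {u : ℝ → VF}
    (hu : Torus.IsWeakTensorPassiveVectorDistortedOn 0 T ((1 / (n:ℝ) ^ 2) • 𝔸) (cellField W M hM ν hν n) (fun _ _ => G₀) F u) :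
    ∀ᵐ t ∂(volume.restrict (Ioo 0 T)), ∀ k' : Fin 3 → ℤ,
      (¬ ∃ z : Fin 3 → ℤ, k' = ℓ + (n : ℤ) • z) → (¬ ∃ z : Fin 3 → ℤ, k' = -ℓ + (n : ℤ) • z) →
      mFourierCoeff (FunctionSpaces.EuclideanSpace.complexify ∘ u t) k' = 0 := by
  have hN : Torus.NearIso ((1 / (n:ℝ) ^ 2) • 𝔸) ((1 / (n:ℝ) ^ 2) * (ν * (lo / lam))) ((1 / (n:ℝ) ^ 2) * (ν * (hi * lam))) :=
    hA.smul (by positivity)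
  have hlo' : 0 < (1 / (n:ℝ) ^ 2) * (ν * (lo / lam)) := by positivity
  have hb : MemLp (FunctionSpaces.Torus.stLift (cellField W M hM ν hν n)) ∞
      (volume.restrict (Ioo 0 T ×ˢ (univ : Set (EuclideanSpace ℝ (Fin 3))))) := by
    rw [cellField_eq_cell]
    exact memLp_top_stLift_cell _ n T
  have hper : ∀ (j : Fin 3 → Fin n) t x, cellField W M hM ν hν n t (x + fun i => ((((j i : ℕ) : ℝ) / n : ℝ) : UnitAddCircle)) =
      cellField W M hM ν hν n t x := fun j t x => by rw [cellField_eq_cell]; exact cell_add_grid _ hn j t x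
  have hsuppSec : ∀ k', mFourierCoeff (FunctionSpaces.EuclideanSpace.complexify ∘ F) k' ≠ 0 →
      (∀ i, (n : ℤ) ∣ k' i - ℓ i) ∨ (∀ i, (n : ℤ) ∣ k' i + ℓ i) := by
    intro k' hk'
    by_contra hcon
    rw [not_or] at hcon
    exact hk' (hsupp k' (mt (class_iff_dvd n ℓ k').1 hcon.1) (mt (negClass_iff_dvd n ℓ k').1 hcon.2))
  filter_upwards [hu.ae_mFourierCoeff_eq_zero_off_sector_constFrame hn ℓ hN hlo' hc₀ hG hb hper hF hsuppSec] with t ht k' h1 h2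
  exact ht k' (fun hor => hor.elim (fun h => h1 ((class_iff_dvd n ℓ k').2 h)) (fun h => h2 ((negClass_iff_dvd n ℓ k').2 h)))

/-- The same in the `modeCoeff` format of `ClassDecayWθ` (datum `H¹`, support hypothesis on `modeCoeff`): for a.e. `t`, every mode of `u t` off the class
pair vanishes, both as `mFourierCoeff` of the complexification and as `modeCoeff`. [cite: KhaKuchment2021, §1.1–§1.2 (G-periodic operators, γ_k-automorphic functions)] -/
theorem ae_modeCoeff_vanish_off_classPair_frame {k : ℕ} (W : LatticeWord k) (M : ℝ) (hM : 0 < M) {lo hi lam ν : ℝ} (hlo : 0 < lo)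
    (hlam : 0 < lam) (hν : 0 < ν) {n : ℕ} (hn : 0 < n) {𝔸 : Torus.Visc4 (Fin 3)}
    (hA : Torus.NearIso 𝔸 (ν * (lo / lam)) (ν * (hi * lam))) {G₀ : Matrix (Fin 3) (Fin 3) ℝ} {c₀ : ℝ} (hc₀ : 0 < c₀)
    (hG : ∀ k' : Fin 3 → ℤ, c₀ * freqNormSq k' ≤ ∑ a, Torus.twistFreq G₀ k' a ^ 2)
    (ℓ : Fin 3 → ℤ) {F : VF} (hF1 : MemSobolev 1 (FunctionSpaces.EuclideanSpace.complexify ∘ F))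
    (hsupp : ∀ k' : Fin 3 → ℤ, (¬ ∃ z : Fin 3 → ℤ, k' = ℓ + (n : ℤ) • z) → (¬ ∃ z : Fin 3 → ℤ, k' = -ℓ + (n : ℤ) • z) →
      ∀ i, modeCoeff k' F i = 0)
    {T : ℝ} {u : ℝ → VF}
    (hu : Torus.IsWeakTensorPassiveVectorDistortedOn 0 T ((1 / (n:ℝ) ^ 2) • 𝔸) (cellField W M hM ν hν n) (fun _ _ => G₀) F u) :
    ∀ᵐ t ∂(volume.restrict (Ioo 0 T)), ∀ k' : Fin 3 → ℤ,
      (¬ ∃ z : Fin 3 → ℤ, k' = ℓ + (n : ℤ) • z) → (¬ ∃ z : Fin 3 → ℤ, k' = -ℓ + (n : ℤ) • z) →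
      mFourierCoeff (FunctionSpaces.EuclideanSpace.complexify ∘ u t) k' = 0 ∧ ∀ i, modeCoeff k' (u t) i = 0 := by
  have hF2 : MemLp F 2 volume := memLp_two_of_memSobolev_one_complexify hF1
  have hFi : Integrable F volume := hF2.integrable one_le_two
  have hsupp' : ∀ k' : Fin 3 → ℤ, (¬ ∃ z : Fin 3 → ℤ, k' = ℓ + (n : ℤ) • z) → (¬ ∃ z : Fin 3 → ℤ, k' = -ℓ + (n : ℤ) • z) →
      mFourierCoeff (FunctionSpaces.EuclideanSpace.complexify ∘ F) k' = 0 := by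
    intro k' h1 h2
    ext i
    rw [← modeCoeff_eq hFi, hsupp k' h1 h2 i]
    rfl
  filter_upwards [ae_modes_vanish_off_classPair_frame W M hM hlo hlam hν hn hA hc₀ hG ℓ hF2 hsupp' hu, hu.ae_integrable_slice] with t ht hint k' h1 h2
  refine ⟨ht k' h1 h2, fun i => ?_⟩
  rw [modeCoeff_eq hint.1, ht k' h1 h2]
  rfl

end Summit.AnomalousDissipation.AnomalousDissipation.Theorems.SolenoidalFractalHomogenisation.LagrangianStep.CellChain

end
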